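import Literature.NumberTheory.PAdicHodge.NeronDeRhamDatumOfDeRham
import Literature.NumberTheory.PAdicHodge.NeronDeRhamDatumRestrict
import Literature.NumberTheory.PAdicHodge.DeRhamEllipticGoodOrdinary
import Literature.NumberTheory.GaloisRepresentations.PotentialDiagonalizabilityCriteriaProofs
import HarnessLib

/-!
# hDR in the curve-over-the-`p`-adic-field form: `V_p(W)|_{Γ_F}` is de Rham iff `V_p(W ×_{K₀} F)` is

Topic `Literature/NumberTheory/PAdicHodge`; namespace `Literature.NumberTheory.PAdicHodge`. THEOREMS ONLY (no definition,
no named fact, no instance, no `sorry`).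

The cite-only de Rham input of the elliptic `p`-adic Hodge facts (`isDeRham_restrictedRationalTateRep`, file
`DualExpElliptic`: "`V_pW|_{Γ_F}` is de Rham for every elliptic `W/K₀`, every `p`-adic field `F ⊇ K₀`") is stated on
the RESTRICTED representation of a curve over a subfield. The sector theorems of the hDR programme
(`DeRhamCyclotomicExtension`, `DeRhamOrdinaryExtension`, `DeRhamEllipticGoodOrdinary`, the descent
`DeRhamDescentModule`) naturally produce de Rham-ness of representations OF `Γ_F` ITSELF. This file provides the
bookkeeping between the two shapes:

* `isDeRham_restrictedRationalTateRep_iff_baseChange` — **`V_p(W)|_{Γ_F}` is de Rham iff `V_p(W ×_{K₀} F)` is**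
  (the restriction isomorphism of Tate modules `rationalTateModuleEquiv`, equivariant along `absGaloisRestrict K₀ F`,
  tree `TateModuleBaseChange`; admissibility is invariant under isomorphism, `isAdmissible_iff_of_equiv`);
* `isDeRham_restrictedRationalTateRep_iff_forall_rationalTateRep` — **hDR ⟺ "for every `p`-adic field `F` and every
  elliptic curve `E` over `F`, `V_pE` is de Rham for `B_dR(F)`"** (`→`: the self-restriction bridge
  `isDeRham_rationalTateRep_of_isDeRham_restricted`; `←`: the previous item);
* `isDeRham_rationalTateRep_baseChange_adicCompletion_of_goodOrdinary` — the good-ORDINARY sector in that form: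
  `V_p(W ×_K K_v)` is de Rham at every place `v ∣ p` of good ordinary reduction of a number-field curve `W/K`
  (`isDeRham_restrictedRationalTateRep_of_goodOrdinary`).

BSD is not proved by any of this; hDR stays cite-only (the supersingular sector is open).

## References
* K. Kato, LNM 1553 (1993), Ch. II Ex. 1.3.5. [Kato1993LNM1553]
* J.-M. Fontaine, Astérisque 223 (1994), Exp. III §1.5 (admissibility is isomorphism-invariant). [FontaineAsterisque223III]
* J. H. Silverman, *AEC* (2009), III.§7, VII.§4 (`T_ℓ` of `E/K` as a `Γ_{K_v}`-module is `T_ℓ(E/K_v)`). [SilvermanAEC2009]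
-/

noncomputable section

open Field ValuativeRel

namespace Literature.NumberTheory.PAdicHodge

open Literature.NumberTheory.GaloisRepresentations
open Literature.NumberTheory.GaloisRepresentations.IsNonarchimedeanLocalField
open Literature.NumberTheory.EllipticCurves WeierstrassCurve

variable {F : Type} [Field F] [ValuativeRel F] [TopologicalSpace F] [IsNonarchimedeanLocalField F]
  [CharZero F] {p : ℕ} [Fact p.Prime] [Fact (¬ IsUnit (p : integerC F))]
  [IsAdicComplete (Ideal.span {(p : integerC F)}) (integerC F)] (hp : valuation F p < 1) [Algebra ℚ_[p] F]

/-- **`V_p(W)|_{Γ_F}` is de Rham iff `V_p(W ×_{K₀} F)` is** (`W` an elliptic curve over a subfield `K₀ ⊆ F`): the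
restriction isomorphism `V_p(W) ⥲ V_p(W ×_{K₀} F)` (`rationalTateModuleEquiv`) is `Γ_F`-equivariant along
`absGaloisRestrict K₀ F`, and `B_dR`-admissibility is invariant under isomorphism of representations.
[cite: SilvermanAEC2009, III.§7 and VII.§4] [cite: FontaineAsterisque223III, Exp. III §1.5] -/
theorem isDeRham_restrictedRationalTateRep_iff_baseChange {K₀ : Type} [Field K₀] [CharZero K₀]
    (W : WeierstrassCurve K₀) [W.IsElliptic] [Algebra K₀ F] :
    GaloisRep.IsDeRham (bdRPeriodRingData (F := F) (p := p) hp) (restrictedRationalTateRep W F p) ↔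
      GaloisRep.IsDeRham (bdRPeriodRingData (F := F) (p := p) hp) (rationalTateRep (W.baseChange F) p) :=
  PeriodRingData.isAdmissible_iff_of_equiv (bdRPeriodRingData (F := F) (p := p) hp)
    (restrictedRationalTateRep W F p) (rationalTateRep (W.baseChange F) p) (rationalTateModuleEquiv W F p)
    (fun σ x => rationalTateModuleEquiv_rationalTateGaloisRep_restrict W F p
      (W.continuous_rationalGaloisRepTate_holds p) ((W.baseChange F).continuous_rationalGaloisRepTate_holds p) σ x)

/-- **hDR in the curve-over-`F` form**: the cite-only fact `isDeRham_restrictedRationalTateRep` holds iff for every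
`p`-adic field `F` (any `ℚ_p`-algebra structure) and every elliptic curve `E` OVER `F`, `V_pE` is de Rham for `B_dR(F)`.
(`→`: at `K₀ = F` the restricted representation is an inner twist of `V_pE`, `isDeRham_rationalTateRep_of_isDeRham_restricted`;
`←`: `isDeRham_restrictedRationalTateRep_iff_baseChange`.) [cite: Kato1993LNM1553, Ch. II Ex. 1.3.5]
[cite: FontaineAsterisque223III, Exp. III §1.5] -/
theorem isDeRham_restrictedRationalTateRep_iff_forall_rationalTateRep :
    isDeRham_restrictedRationalTateRep ↔
      ∀ {F : Type} [Field F] [ValuativeRel F] [TopologicalSpace F] [IsNonarchimedeanLocalField F]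
        [CharZero F] {p : ℕ} [Fact p.Prime] [Fact (¬ IsUnit (p : integerC F))]
        [IsAdicComplete (Ideal.span {(p : integerC F)}) (integerC F)] [Algebra ℚ_[p] F]
        (hp : valuation F p < 1) (E : WeierstrassCurve F) [E.IsElliptic],
        GaloisRep.IsDeRham (bdRPeriodRingData (F := F) (p := p) hp) (rationalTateRep E p) := by
  constructor
  · intro hDR F _ _ _ _ _ p _ _ _ _ hp E _
    exact isDeRham_rationalTateRep_of_isDeRham_restricted hp hDR E
  · intro h K₀ _ _ W _ F _ _ _ _ _ _ p _ _ _ hp _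
    exact (isDeRham_restrictedRationalTateRep_iff_baseChange hp W).2 (h hp (W.baseChange F))

/-- **The good-ORDINARY sector in the curve-over-`K_v` form**: for an elliptic curve `W` over a number field `K` and a
place `v ∣ p` of good ordinary reduction, `V_p(W ×_K K_v)` is de Rham for `B_dR(K_v)`.
[cite: Greenberg1991, §2 (the ordinary filtration)] [cite: BlochKato1990, Cor. 3.8.4 and Example 3.9] -/
theorem isDeRham_rationalTateRep_baseChange_adicCompletion_of_goodOrdinary {K : Type} [Field K] [NumberField K]
    (W : WeierstrassCurve K) [W.IsElliptic] (v : IsDedekindDomain.HeightOneSpectrum (NumberField.RingOfIntegers K))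
    (hv : (p : NumberField.RingOfIntegers K) ∈ v.asIdeal) (hgood : W.HasGoodReductionAt v)
    (hord : ¬ ((p : ℤ) ∣ W.frobeniusTraceAt v))
    [CharZero (v.adicCompletion K)] [Fact (¬ IsUnit (p : integerC (v.adicCompletion K)))]
    [IsAdicComplete (Ideal.span {(p : integerC (v.adicCompletion K))}) (integerC (v.adicCompletion K))]
    (hp : valuation (v.adicCompletion K) p < 1) [Algebra ℚ_[p] (v.adicCompletion K)] :
    GaloisRep.IsDeRham (bdRPeriodRingData (F := v.adicCompletion K) (p := p) hp)
      (rationalTateRep (W.baseChange (v.adicCompletion K)) p) :=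
  (isDeRham_restrictedRationalTateRep_iff_baseChange hp W).1
    (isDeRham_restrictedRationalTateRep_of_goodOrdinary W v hv hgood hord hp)

end Literature.NumberTheory.PAdicHodge

end
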